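import Summits.QuantumFields.BalabanUV.Beta.EriceRemainderEnclosureHistoryAutonomyComparisonAffineProfile

/-!
# EriceRemainderEnclosureHistoryAutonomyComparisonShapeProfile — (E59a) SUBLINEAR MEMORY SHAPES: memories dominated by `Σ_{k<K} L_k·ψ(u_k)` with ONE
# shape `ψ ≥ 0`, non-decreasing and SUB-HOMOGENEOUS (`s·ψ(x) ≤ ψ(s·x)`, `0 ≤ s ≤ 1` — every concave `ψ` with `ψ(0⁺) ≥ 0`: saturating memories
# `min(u, σ)`, `u∕(1+u)`, `log(1+u)`, …) compare at ANY size under the SAME trajectory-free profile condition `Σ_{j<K} L_j ∕ P_j ≤ 2`,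
# `P_j = Σ_{k<K} L_k·√(j∕(j+k))`, as the affine profiles of (E58b) (`le_of_isotone_excess_dom_shape_profile`, `le_of_isotone_excess_shape_profile`)

Cell `pub-balaban`, β-function sub-cell, BINDER row D4 «RemainderConst leaves for Bałaban's split» (`HOME/BINDER-OWNERS.md`; owner lineage `b2b-balaban-beta-an4`;
this file by co-owner #2 lineage `b2b-balaban-beta-d4-p2`, generation 51), β-FLOW TEAM duty (1), FREEZE (0) honoured (def-free: the shape `ψ : ℝ → ℝ` is a
bound variable with displayed hypotheses, the model functional the displayed lambda term `fun u ↦ b + Σ_{k<K} L_k·ψ(u_k)`; (E58a)'s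
`le_of_isotone_excess_of_step`, (E58b)'s `mul_sqrt_le_read` ∕ `profile_pos`, (E49j)'s `excess_shift_le`, (E48a)'s `strictAnti_of_memFlow`, node U2's
`invSq_eq_of_memFlow` ∕ `drive` ∕ `seqBox_shift` ∕ `Sharpness.abs_sub_le_half_cube_mul` BY NAME; nothing restated).  Second station of gen 51 after (E58)
`…ComparisonPrinciple` ∕ `…ComparisonAffineProfile(End)` (affine profiles: `ψ = id`).

HONEST FRAMING (page 1, verbatim and binding).  *"Discharging BetaPertH makes Bałaban's UV stability UNCONDITIONAL — a real constructive-QFT result; it is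
NOT the continuum limit and NOT the Clay problem."*  THIS FILE DISCHARGES NOTHING OF THE KIND.  Elementary real analysis about ABSTRACT functionals on a box
]0,γ]^ℕ with displayed signs, domination, moduli and a displayed shape — hypotheses of a census, not facts; the form of Bałaban's (1.22) limit functional
(in particular whether its memory is linear, saturating or anything else) is NOT PRINTED ([I] p. 298; GAPS G-t4-U2-1∕-2) and NOT asserted.  Row D4 class
UNCHANGED (critical-path width 0; instance 0∕1; D4 DISCHARGE NO DATE).  HONEST DEPENDENCY: continuum YM on T⁴ ⇐ BetaPertH ∧ nine spine estimates (0/9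
proved); BetaPertH ⇐ (D1) ∧ (D4) ∧ CAP+tail; G-an2-4 gates asym, D1 and NE2/3/4.

THE POINT (census sense (α); the COMPARISON column).  (E58b)'s chain uses linearity of the profile terms at two places only: the DROP of one term between
the two trajectories, `L_k·(h_k − h′_k)`, and the READ inequality `h_{j+k} ≥ √(j∕(j+k))·h_j` turned into a bound on the term read at scale `j`.  Both survive
for a SUB-HOMOGENEOUS non-decreasing shape `ψ ≥ 0`: `ψ(x) − ψ(x′) ≤ ψ(x)·(x − x′)∕x` for `x′ ≤ x` (§1 `shape_drop_le` — the chord to the origin lies below a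
sub-homogeneous function) and `ψ(h_{j+k}) ≥ √(j∕(j+k))·ψ(h_j)` (§1 `shape_read_ge`).  Hence, with the SHAPE WEIGHT `Q_ψ = Σ_k L_k·k·ψ(h_k)·h_k²` in place of
`Σ_k L_k·k·h_k³`: the drop under comparison from the pin is `≤ (Q_ψ∕2)·η` (§3 `effective_le_of_family_le_at_dom_shape_of_weight`), and along EVERY box solution
from EVERY pin **`L_j·j·ψ(h_j)·h_j² ≤ L_j ∕ P_j`** with the SAME profile sum `P_j = Σ_{k<K} L_k·√(j∕(j+k))` as in the affine case (§2 `shape_weight_le_profile`,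
from `a_j ≥ j·Σ_k L_k·ψ(h_{j+k}) ≥ j·ψ(h_j)·P_j`).  So every memory dominated by `Σ_k L_k·ψ(u_k)` (`B u ≥ Σ_k L_k·ψ(u_k)`, `B u − B u′ ≤ Σ_k L_k·(ψ(u_k) − ψ(u′_k))`
for `u′ ≤ u` at fixed newest entry) compares at ANY size under every isotone excess with a zeroth moment as soon as the profile passes `Σ_j L_j∕P_j ≤ 2` (§4
`le_of_isotone_excess_dom_shape_profile`) — the model `b + Σ_k L_k·ψ(u_k)` with `ψ` Lipschitz included (`le_of_isotone_excess_shape_profile`); the classes of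
(E58c) (one age; all memory ages within a factor 3; `Σ_k L_k ≤ 3·L_0`) carry over verbatim since the condition is on `L` alone.  The concrete saturating
shape `min(u, σ)` is the sequel's ((E59b) `…ComparisonShapeProfileEnd`).  NOT CLAIMED: anything for CONVEX shapes (`u²`-type memory terms grow their slope
along the trajectory; the drop bound fails) beyond what a Markov term at age `0` gives for free; necessity of the condition; anything printed.

WHAT IS PROVED ([folklore]; 0 `def`, 0 sorry).  §1 `shape_drop_le`, `shape_read_ge`.  §2 `mul_shape_read_le_invSq_of_dom`, **`shape_weight_le_profile`**,
**`shape_weightSum_le_profileSum`**.  §3 **`effective_le_of_family_le_at_dom_shape_of_weight`**, `effective_le_of_family_le_at_dom_shape_of_profile`.  §4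
**`le_of_isotone_excess_dom_shape_profile`**, `shape_functional_monotone`, `shape_functional_floor`, `shape_functional_zerothMoment`,
**`le_of_isotone_excess_shape_profile`**.
-/
noncomputable section
open Finset Set

namespace Summit.QuantumFields.BalabanUV.Beta.EriceRemainderEnclosureHistoryAutonomyComparisonShapeProfile

open Literature.MathematicalPhysics.QuantumFieldTheory.Balaban1983to89
open Literature.MathematicalPhysics.QuantumFieldTheory.Balaban1983to89.T4BetaStationary
open Literature.MathematicalPhysics.QuantumFieldTheory.Balaban1983to89.T4BetaFlowWellPosed
open Literature.MathematicalPhysics.QuantumFieldTheory.Balaban1983to89.T4BetaFlowWellPosed.Sharpness (abs_sub_le_half_cube_mul)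
open Summit.QuantumFields.BalabanUV.Beta.EriceRemainderEnclosureHistoryAutonomyOrder (strictAnti_of_memFlow)
open Summit.QuantumFields.BalabanUV.Beta.EriceRemainderEnclosureHistoryAutonomyComparisonExcess (excess_shift_le)
open Summit.QuantumFields.BalabanUV.Beta.EriceRemainderEnclosureHistoryAutonomyComparisonPrinciple (le_of_isotone_excess_of_step)
open Summit.QuantumFields.BalabanUV.Beta.EriceRemainderEnclosureHistoryAutonomyComparisonAffineProfile (mul_sqrt_le_read profile_pos)

variable {B B' : (ℕ → ℝ) → ℝ} {ψ : ℝ → ℝ} {M M' Λ γ b y : ℝ} {L : ℕ → ℝ} {K : ℕ} {h h' : ℕ → ℝ}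

/-! ## §1 The two shape inequalities: drop along the chord to the origin, reads under sub-homogeneity -/

/-- **THE DROP OF A SUB-HOMOGENEOUS SHAPE**: `ψ ≥ 0` on ]0,γ] with `s·ψ(x) ≤ ψ(s·x)` for `0 ≤ s ≤ 1`; then for `0 < x′ ≤ x ≤ γ`:
`ψ(x) − ψ(x′) ≤ ψ(x)·(x − x′)∕x` (take `s = x′∕x`). [folklore] -/
theorem shape_drop_le (hψsub : ∀ s x : ℝ, 0 ≤ s → s ≤ 1 → 0 < x → x ≤ γ → s * ψ x ≤ ψ (s * x))
    {x x' : ℝ} (hx' : 0 < x') (hx'x : x' ≤ x) (hxγ : x ≤ γ) : ψ x - ψ x' ≤ ψ x * ((x - x') / x) := by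
  have hx : 0 < x := hx'.trans_le hx'x
  have hs := hψsub (x' / x) x (div_nonneg hx'.le hx.le) ((div_le_one hx).mpr hx'x) hx hxγ
  rw [div_mul_cancel₀ x' hx.ne'] at hs
  have e : ψ x * ((x - x') / x) = ψ x - x' / x * ψ x := by rw [sub_div, div_self hx.ne']; ring
  rw [e]; linarith

/-- **THE READS OF A SUB-HOMOGENEOUS NON-DECREASING SHAPE ALONG AN ISOTONE MEMORY'S SOLUTION**: `√(j∕(j+k))·ψ(h_j) ≤ ψ(h_{j+k})` — from (E58b)
`mul_sqrt_le_read` (`√(j∕(j+k))·h_j ≤ h_{j+k}`), monotonicity and sub-homogeneity of `ψ`. [folklore] -/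
theorem shape_read_ge (hmono : ∀ u v : ℕ → ℝ, SeqBox γ u → SeqBox γ v → (∀ j, u j ≤ v j) → B u ≤ B v) (hb : 0 < b)
    (hlo : ∀ u, SeqBox γ u → b ≤ B u) (hψmono : ∀ x x' : ℝ, 0 < x → x ≤ x' → x' ≤ γ → ψ x ≤ ψ x')
    (hψsub : ∀ s x : ℝ, 0 ≤ s → s ≤ 1 → 0 < x → x ≤ γ → s * ψ x ≤ ψ (s * x))
    (hy : 0 < y) (hh : SeqBox γ h) (hf : MemFlow B y h) {j : ℕ} (hj : 1 ≤ j) (k : ℕ) :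
    Real.sqrt ((j : ℝ) / ((j : ℝ) + k)) * ψ (h j) ≤ ψ (h (j + k)) := by
  have hread := mul_sqrt_le_read hmono hb hlo hy hh hf j k
  have hjr : (0 : ℝ) < j := by exact_mod_cast hj
  have hs0 : 0 ≤ Real.sqrt ((j : ℝ) / ((j : ℝ) + k)) := Real.sqrt_nonneg _
  have hs1 : Real.sqrt ((j : ℝ) / ((j : ℝ) + k)) ≤ 1 := by
    rw [Real.sqrt_le_one]; exact (div_le_one (by positivity)).mpr (by linarith [(Nat.cast_nonneg k : (0 : ℝ) ≤ k)])
  have hspos : 0 < Real.sqrt ((j : ℝ) / ((j : ℝ) + k)) := Real.sqrt_pos.mpr (div_pos hjr (by positivity))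
  calc Real.sqrt ((j : ℝ) / ((j : ℝ) + k)) * ψ (h j) ≤ ψ (Real.sqrt ((j : ℝ) / ((j : ℝ) + k)) * h j) :=
        hψsub _ _ hs0 hs1 (hh j).1 (hh j).2
    _ ≤ ψ (h (j + k)) := hψmono _ _ (mul_pos hspos (hh j).1) hread (hh (j + k)).2

/-! ## §2 The shape weight is bounded by the SAME profile sum -/

/-- Domination by the shape profile drives the levels: `j·Σ_k L_k·ψ(h(j+k)) ≤ 1∕h(j)²` (`B u ≥ Σ_k L_k·ψ(u_k)`, `ψ` non-decreasing, `L ≥ 0`). [folklore] -/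
theorem mul_shape_read_le_invSq_of_dom (hL : ∀ k, 0 ≤ L k) (hb : 0 < b) (hlo : ∀ u, SeqBox γ u → b ≤ B u)
    (hdom : ∀ u, SeqBox γ u → ∑ k ∈ range K, L k * ψ (u k) ≤ B u) (hψmono : ∀ x x' : ℝ, 0 < x → x ≤ x' → x' ≤ γ → ψ x ≤ ψ x')
    (hy : 0 < y) (hh : SeqBox γ h) (hf : MemFlow B y h) (j : ℕ) :
    (j : ℝ) * ∑ k ∈ range K, L k * ψ (h (j + k)) ≤ 1 / h j ^ 2 := by
  have hanti := (strictAnti_of_memFlow hb hlo hh hf).antitone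
  rw [invSq_eq_of_memFlow hf j]
  unfold drive
  have hterm : ∀ l ∈ range j, ∑ k ∈ range K, L k * ψ (h (j + k)) ≤ B (fun i => h (l + 1 + i)) := by
    intro l hl
    have hl' : l < j := mem_range.mp hl
    have hs : ∑ k ∈ range K, L k * ψ (h (j + k)) ≤ ∑ k ∈ range K, L k * ψ (h (l + 1 + k)) :=
      sum_le_sum fun k _ => mul_le_mul_of_nonneg_left
        (hψmono _ _ (hh (j + k)).1 (hanti (by omega)) (hh (l + 1 + k)).2) (hL k)
    exact hs.trans (hdom _ (seqBox_shift hh (l + 1)))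
  have hsum := sum_le_sum hterm
  rw [sum_const, card_range, nsmul_eq_mul] at hsum
  have : 0 < 1 / y ^ 2 := by positivity
  linarith

/-- **THE SHAPE WEIGHT OF EACH AGE IS BOUNDED BY THE PROFILE**: `L_j·j·ψ(h_j)·h_j² ≤ L_j ∕ P_j`, `P_j = Σ_{k<K} L_k·√(j∕(j+k))` — the SAME sum as for
affine profiles — along every box solution from every pin of an isotone memory with floor dominated by `Σ_k L_k·ψ(u_k)` (`ψ ≥ 0` non-decreasing
sub-homogeneous): from `1∕h_j² ≥ j·Σ_k L_k·ψ(h_{j+k}) ≥ j·ψ(h_j)·P_j`. [folklore] -/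
theorem shape_weight_le_profile (hmono : ∀ u v : ℕ → ℝ, SeqBox γ u → SeqBox γ v → (∀ j, u j ≤ v j) → B u ≤ B v)
    (hL : ∀ k, 0 ≤ L k) (hb : 0 < b) (hlo : ∀ u, SeqBox γ u → b ≤ B u)
    (hdom : ∀ u, SeqBox γ u → ∑ k ∈ range K, L k * ψ (u k) ≤ B u) (hψnn : ∀ x : ℝ, 0 < x → x ≤ γ → 0 ≤ ψ x)
    (hψmono : ∀ x x' : ℝ, 0 < x → x ≤ x' → x' ≤ γ → ψ x ≤ ψ x')
    (hψsub : ∀ s x : ℝ, 0 ≤ s → s ≤ 1 → 0 < x → x ≤ γ → s * ψ x ≤ ψ (s * x))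
    (hy : 0 < y) (hh : SeqBox γ h) (hf : MemFlow B y h) {j : ℕ} (hjK : j ∈ range K) :
    L j * j * ψ (h j) * h j ^ 2 ≤ L j / ∑ k ∈ range K, L k * Real.sqrt ((j : ℝ) / ((j : ℝ) + k)) := by
  have hj := (hh j).1
  have hψj := hψnn _ hj (hh j).2
  rcases Nat.eq_zero_or_pos j with rfl | hjpos
  · have hP0 : ∑ k ∈ range K, L k * Real.sqrt (((0 : ℕ) : ℝ) / (((0 : ℕ) : ℝ) + k)) = 0 :=
      sum_eq_zero fun k _ => by simp
    rw [hP0]; simp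
  rcases (hL j).eq_or_lt with hLj | hLj
  · rw [← hLj]; simp
  have hP := profile_pos hL hjK hjpos hLj
  set P := ∑ k ∈ range K, L k * Real.sqrt ((j : ℝ) / ((j : ℝ) + k)) with hP_def
  have hread : ψ (h j) * P ≤ ∑ k ∈ range K, L k * ψ (h (j + k)) := by
    rw [hP_def, mul_sum]
    exact sum_le_sum fun k _ => by
      have := shape_read_ge hmono hb hlo hψmono hψsub hy hh hf hjpos k
      calc ψ (h j) * (L k * Real.sqrt ((j : ℝ) / ((j : ℝ) + k))) = L k * (Real.sqrt ((j : ℝ) / ((j : ℝ) + k)) * ψ (h j)) := by ring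
        _ ≤ L k * ψ (h (j + k)) := mul_le_mul_of_nonneg_left this (hL k)
  have hlev := mul_shape_read_le_invSq_of_dom hL hb hlo hdom hψmono hy hh hf j
  have hjr : (0 : ℝ) ≤ j := Nat.cast_nonneg j
  have hkey : (j : ℝ) * (ψ (h j) * P) ≤ 1 / h j ^ 2 := (mul_le_mul_of_nonneg_left hread hjr).trans hlev
  rw [le_div_iff₀ hP]
  have h3 : (j : ℝ) * ψ (h j) * h j ^ 2 * P ≤ 1 := by
    have := mul_le_mul_of_nonneg_right hkey (sq_nonneg (h j))
    rw [one_div_mul_cancel (by positivity)] at this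
    calc (j : ℝ) * ψ (h j) * h j ^ 2 * P = (j : ℝ) * (ψ (h j) * P) * h j ^ 2 := by ring
      _ ≤ 1 := this
  calc L j * j * ψ (h j) * h j ^ 2 * P = L j * ((j : ℝ) * ψ (h j) * h j ^ 2 * P) := by ring
    _ ≤ L j * 1 := mul_le_mul_of_nonneg_left h3 hLj.le
    _ = L j := mul_one _

/-- **THE SHAPE WEIGHT IS BOUNDED BY THE PROFILE SUM**: `Q_ψ = Σ_{j<K} L_j·j·ψ(h_j)·h_j² ≤ Σ_{j<K} L_j ∕ P_j` — by the profile `L` ALONE. [folklore] -/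
theorem shape_weightSum_le_profileSum (hmono : ∀ u v : ℕ → ℝ, SeqBox γ u → SeqBox γ v → (∀ j, u j ≤ v j) → B u ≤ B v)
    (hL : ∀ k, 0 ≤ L k) (hb : 0 < b) (hlo : ∀ u, SeqBox γ u → b ≤ B u)
    (hdom : ∀ u, SeqBox γ u → ∑ k ∈ range K, L k * ψ (u k) ≤ B u) (hψnn : ∀ x : ℝ, 0 < x → x ≤ γ → 0 ≤ ψ x)
    (hψmono : ∀ x x' : ℝ, 0 < x → x ≤ x' → x' ≤ γ → ψ x ≤ ψ x')
    (hψsub : ∀ s x : ℝ, 0 ≤ s → s ≤ 1 → 0 < x → x ≤ γ → s * ψ x ≤ ψ (s * x))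
    (hy : 0 < y) (hh : SeqBox γ h) (hf : MemFlow B y h) :
    ∑ j ∈ range K, L j * j * ψ (h j) * h j ^ 2 ≤ ∑ j ∈ range K, L j / ∑ k ∈ range K, L k * Real.sqrt ((j : ℝ) / ((j : ℝ) + k)) :=
  sum_le_sum fun _ hj => shape_weight_le_profile hmono hL hb hlo hdom hψnn hψmono hψsub hy hh hf hj

/-! ## §3 THE STEP: the drop is at most `(Q_ψ∕2)·η` -/

/-- **THE STEP FROM THE SHAPE WEIGHT.**  `B` isotone with floor `b > 0`, Lipschitz ALONG THE SHAPE PROFILE at fixed newest entry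
(`B u − B u′ ≤ Σ_{k<K} L_k·(ψ(u_k) − ψ(u′_k))` for `u′ ≤ u`, `u′_0 = u_0`; `L ≥ 0`; `ψ ≥ 0` sub-homogeneous); `B ≤ B′` with ISOTONE excess; `h`, `h′` box solutions
from one pin `y` with `h′ ≤ h`, and `Q_ψ = Σ_k L_k·k·ψ(h_k)·h_k² ≤ 2`.  Then `B h ≤ B′ h′`: levels differ by `≤ k·η` at scale `k`, each term drops by
`≤ L_k·ψ(h_k)·(h_k − h′_k)∕h_k ≤ L_k·ψ(h_k)·(h_k²∕2)·k·η`. [folklore] -/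
theorem effective_le_of_family_le_at_dom_shape_of_weight
    (hmono : ∀ u v : ℕ → ℝ, SeqBox γ u → SeqBox γ v → (∀ j, u j ≤ v j) → B u ≤ B v) (hL : ∀ k, 0 ≤ L k) (hb : 0 < b)
    (hlo : ∀ u, SeqBox γ u → b ≤ B u)
    (hdrop : ∀ u u' : ℕ → ℝ, SeqBox γ u → SeqBox γ u' → (∀ j, u' j ≤ u j) → u' 0 = u 0 →
      B u - B u' ≤ ∑ k ∈ range K, L k * (ψ (u k) - ψ (u' k)))
    (hψnn : ∀ x : ℝ, 0 < x → x ≤ γ → 0 ≤ ψ x) (hψsub : ∀ s x : ℝ, 0 ≤ s → s ≤ 1 → 0 < x → x ≤ γ → s * ψ x ≤ ψ (s * x))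
    (hexc : ∀ u, SeqBox γ u → B u ≤ B' u)
    (hDmono : ∀ u v : ℕ → ℝ, SeqBox γ u → SeqBox γ v → (∀ j, u j ≤ v j) → B' u - B u ≤ B' v - B v)
    (hh : SeqBox γ h) (hf : MemFlow B y h) (hh' : SeqBox γ h') (hf' : MemFlow B' y h') (hle : ∀ j, h' j ≤ h j)
    (hQ : ∑ k ∈ range K, L k * k * ψ (h k) * h k ^ 2 ≤ 2) : B h ≤ B' h' := by
  have hlo' : ∀ u, SeqBox γ u → b ≤ B' u := fun u hu => (hlo u hu).trans (hexc u hu)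
  have hanti' : Antitone h' := (strictAnti_of_memFlow hb hlo' hh' hf').antitone
  set η : ℝ := B' h' - B h' with hη_def
  have hη0 : 0 ≤ η := by rw [hη_def]; linarith [hexc h' hh']
  have hηs : ∀ n, |B (fun j => h' (n + 1 + j)) - B' (fun j => h' (n + 1 + j))| ≤ η := excess_shift_le hexc hDmono hh' hanti'
  -- levels: 0 ≤ a′_k − a_k ≤ k·η
  have hlev : ∀ k : ℕ, 1 / h' k ^ 2 - 1 / h k ^ 2 ≤ (k : ℝ) * η := by
    intro k
    rw [invSq_eq_of_memFlow hf k, invSq_eq_of_memFlow hf' k,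
      show (1:ℝ) / y ^ 2 + drive B' h' k - (1 / y ^ 2 + drive B h k) = drive B' h' k - drive B h k by ring]
    unfold drive
    rw [← sum_sub_distrib]
    calc ∑ l ∈ range k, (B' (fun i => h' (l + 1 + i)) - B (fun i => h (l + 1 + i)))
        ≤ ∑ _l ∈ range k, η := sum_le_sum fun l _ => by
          have e1 := (abs_le.mp (hηs l)).1
          have e2 := hmono _ _ (seqBox_shift hh' (l + 1)) (seqBox_shift hh (l + 1)) fun i => hle (l + 1 + i)
          linarith
      _ = (k : ℝ) * η := by rw [sum_const, card_range, nsmul_eq_mul]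
  have hlev0 : ∀ k : ℕ, 0 ≤ 1 / h' k ^ 2 - 1 / h k ^ 2 := fun k =>
    sub_nonneg.mpr (one_div_le_one_div_of_le (pow_pos (hh' k).1 2) (pow_le_pow_left₀ (hh' k).1.le (hle k) 2))
  -- the coupling gap at scale k
  have hgap : ∀ k : ℕ, h k - h' k ≤ h k ^ 3 / 2 * ((k : ℝ) * η) := by
    intro k
    have hw := abs_sub_le_half_cube_mul (hh k).1 (hh' k).1 le_rfl (hle k)
    have habs : |1 / h k ^ 2 - 1 / h' k ^ 2| ≤ (k : ℝ) * η := by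
      rw [abs_sub_comm, abs_of_nonneg (hlev0 k)]; exact hlev k
    exact (le_abs_self _).trans (hw.trans (mul_le_mul_of_nonneg_left habs (by have := (hh k).1; positivity)))
  -- the shape gap at scale k: ψ(h_k) − ψ(h′_k) ≤ ψ(h_k)·(h_k − h′_k)/h_k ≤ ψ(h_k)·(h_k²/2)·k·η
  have hsgap : ∀ k : ℕ, ψ (h k) - ψ (h' k) ≤ ψ (h k) * h k ^ 2 / 2 * ((k : ℝ) * η) := by
    intro k
    have hk := (hh k).1
    have h1 := shape_drop_le hψsub (hh' k).1 (hle k) (hh k).2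
    have h2 : (h k - h' k) / h k ≤ h k ^ 2 / 2 * ((k : ℝ) * η) := by
      rw [div_le_iff₀ hk]
      calc h k - h' k ≤ h k ^ 3 / 2 * ((k : ℝ) * η) := hgap k
        _ = h k ^ 2 / 2 * ((k : ℝ) * η) * h k := by ring
    calc ψ (h k) - ψ (h' k) ≤ ψ (h k) * ((h k - h' k) / h k) := h1
      _ ≤ ψ (h k) * (h k ^ 2 / 2 * ((k : ℝ) * η)) := mul_le_mul_of_nonneg_left h2 (hψnn _ hk (hh k).2)
      _ = ψ (h k) * h k ^ 2 / 2 * ((k : ℝ) * η) := by ring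
  -- the drop
  have hdrop' : B h - B h' ≤ η := by
    have h0 : h' 0 = h 0 := by rw [hf.1, hf'.1]
    calc B h - B h' ≤ ∑ k ∈ range K, L k * (ψ (h k) - ψ (h' k)) := hdrop h h' hh hh' hle h0
      _ ≤ ∑ k ∈ range K, L k * (ψ (h k) * h k ^ 2 / 2 * ((k : ℝ) * η)) :=
          sum_le_sum fun k _ => mul_le_mul_of_nonneg_left (hsgap k) (hL k)
      _ = (∑ k ∈ range K, L k * k * ψ (h k) * h k ^ 2) / 2 * η := by
          rw [sum_div, sum_mul]; exact sum_congr rfl fun k _ => by ring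
      _ ≤ 2 / 2 * η := mul_le_mul_of_nonneg_right (div_le_div_of_nonneg_right hQ zero_le_two) hη0
      _ = η := by ring
  rw [hη_def] at hdrop'
  linarith

/-- **THE STEP FROM THE PROFILE CONDITION** for the shape class (domination `Σ_k L_k·ψ(u_k) ≤ B u` added, for the weight bound). [folklore] -/
theorem effective_le_of_family_le_at_dom_shape_of_profile
    (hmono : ∀ u v : ℕ → ℝ, SeqBox γ u → SeqBox γ v → (∀ j, u j ≤ v j) → B u ≤ B v) (hL : ∀ k, 0 ≤ L k) (hb : 0 < b)
    (hlo : ∀ u, SeqBox γ u → b ≤ B u) (hdom : ∀ u, SeqBox γ u → ∑ k ∈ range K, L k * ψ (u k) ≤ B u)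
    (hdrop : ∀ u u' : ℕ → ℝ, SeqBox γ u → SeqBox γ u' → (∀ j, u' j ≤ u j) → u' 0 = u 0 →
      B u - B u' ≤ ∑ k ∈ range K, L k * (ψ (u k) - ψ (u' k)))
    (hψnn : ∀ x : ℝ, 0 < x → x ≤ γ → 0 ≤ ψ x) (hψmono : ∀ x x' : ℝ, 0 < x → x ≤ x' → x' ≤ γ → ψ x ≤ ψ x')
    (hψsub : ∀ s x : ℝ, 0 ≤ s → s ≤ 1 → 0 < x → x ≤ γ → s * ψ x ≤ ψ (s * x))
    (hP : ∑ j ∈ range K, L j / ∑ k ∈ range K, L k * Real.sqrt ((j : ℝ) / ((j : ℝ) + k)) ≤ 2)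
    (hexc : ∀ u, SeqBox γ u → B u ≤ B' u)
    (hDmono : ∀ u v : ℕ → ℝ, SeqBox γ u → SeqBox γ v → (∀ j, u j ≤ v j) → B' u - B u ≤ B' v - B v)
    (hy : 0 < y) (hh : SeqBox γ h) (hf : MemFlow B y h) (hh' : SeqBox γ h') (hf' : MemFlow B' y h') (hle : ∀ j, h' j ≤ h j) :
    B h ≤ B' h' :=
  effective_le_of_family_le_at_dom_shape_of_weight hmono hL hb hlo hdrop hψnn hψsub hexc hDmono hh hf hh' hf' hle
    ((shape_weightSum_le_profileSum hmono hL hb hlo hdom hψnn hψmono hψsub hy hh hf).trans hP)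

/-! ## §4 ENDs: the dominated shape class, and the model `b + Σ_k L_k·ψ(u_k)` -/

/-- **MEMORIES DOMINATED BY A SUBLINEAR SHAPE PROFILE COMPARE AT ANY SIZE UNDER THE PROFILE CONDITION.**  `B` ISOTONE on ]0,γ] with floor `b > 0` and
zeroth moment `M ≥ 0` (ANY size); a shape `ψ ≥ 0`, non-decreasing and sub-homogeneous on ]0,γ]; a profile `L ≥ 0` with `Σ_{k<K} L_k·ψ(u_k) ≤ B u` and
`B u − B u′ ≤ Σ_k L_k·(ψ(u_k) − ψ(u′_k))` for `u′ ≤ u` at fixed newest entry; **`Σ_{j<K} L_j ∕ P_j ≤ 2`**, `P_j = Σ_{k<K} L_k·√(j∕(j+k))`; `B′` with zeroth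
moment `M′ ≥ 0`, `B ≤ B′`, ISOTONE excess.  Then ANY box solutions `h`, `h′` of `B`, `B′` from one pin `p ∈ ]0,γ]` satisfy `h′ ≤ h` at every scale. [folklore] -/
theorem le_of_isotone_excess_dom_shape_profile {p : ℝ}
    (hmono : ∀ u v : ℕ → ℝ, SeqBox γ u → SeqBox γ v → (∀ j, u j ≤ v j) → B u ≤ B v)
    (hB : ∀ u u' : ℕ → ℝ, SeqBox γ u → SeqBox γ u' → ∀ D : ℝ, (∀ j, |u j - u' j| ≤ D) → |B u - B u'| ≤ M * D) (hM : 0 ≤ M)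
    (hL : ∀ k, 0 ≤ L k) (hb : 0 < b) (hlo : ∀ u, SeqBox γ u → b ≤ B u)
    (hdom : ∀ u, SeqBox γ u → ∑ k ∈ range K, L k * ψ (u k) ≤ B u)
    (hdrop : ∀ u u' : ℕ → ℝ, SeqBox γ u → SeqBox γ u' → (∀ j, u' j ≤ u j) → u' 0 = u 0 →
      B u - B u' ≤ ∑ k ∈ range K, L k * (ψ (u k) - ψ (u' k)))
    (hψnn : ∀ x : ℝ, 0 < x → x ≤ γ → 0 ≤ ψ x) (hψmono : ∀ x x' : ℝ, 0 < x → x ≤ x' → x' ≤ γ → ψ x ≤ ψ x')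
    (hψsub : ∀ s x : ℝ, 0 ≤ s → s ≤ 1 → 0 < x → x ≤ γ → s * ψ x ≤ ψ (s * x))
    (hP : ∑ j ∈ range K, L j / ∑ k ∈ range K, L k * Real.sqrt ((j : ℝ) / ((j : ℝ) + k)) ≤ 2)
    (hB' : ∀ u u' : ℕ → ℝ, SeqBox γ u → SeqBox γ u' → ∀ D : ℝ, (∀ j, |u j - u' j| ≤ D) → |B' u - B' u'| ≤ M' * D) (hM' : 0 ≤ M')
    (hexc : ∀ u, SeqBox γ u → B u ≤ B' u)
    (hDmono : ∀ u v : ℕ → ℝ, SeqBox γ u → SeqBox γ v → (∀ j, u j ≤ v j) → B' u - B u ≤ B' v - B v)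
    (hp : 0 < p) (hpγ : p ≤ γ) (hh : SeqBox γ h) (hf : MemFlow B p h) (hh' : SeqBox γ h') (hf' : MemFlow B' p h') (j : ℕ) :
    h' j ≤ h j :=
  le_of_isotone_excess_of_step hmono hB hM hb hlo hB' hM' hexc hDmono
    (fun _ hy _ _ _ hu hfu hu' hfu' hle => effective_le_of_family_le_at_dom_shape_of_profile hmono hL hb hlo hdom hdrop hψnn hψmono hψsub hP
      hexc hDmono hy hu hfu hu' hfu' hle)
    hp hpγ hh hf hh' hf' j

/-- The model functional `u ↦ b + Σ_{k<K} L_k·ψ(u_k)` is ISOTONE on the box (`L ≥ 0`, `ψ` non-decreasing on ]0,γ]). [folklore] -/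
theorem shape_functional_monotone (hL : ∀ k, 0 ≤ L k) (hψmono : ∀ x x' : ℝ, 0 < x → x ≤ x' → x' ≤ γ → ψ x ≤ ψ x') :
    ∀ u v : ℕ → ℝ, SeqBox γ u → SeqBox γ v → (∀ j, u j ≤ v j) →
      (fun w : ℕ → ℝ => b + ∑ k ∈ range K, L k * ψ (w k)) u ≤ (fun w : ℕ → ℝ => b + ∑ k ∈ range K, L k * ψ (w k)) v :=
  fun _ _ hu hv huv => add_le_add le_rfl
    (sum_le_sum fun k _ => mul_le_mul_of_nonneg_left (hψmono _ _ (hu k).1 (huv k) (hv k).2) (hL k))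

/-- … has FLOOR `b` (`ψ ≥ 0` on ]0,γ]). [folklore] -/
theorem shape_functional_floor (hL : ∀ k, 0 ≤ L k) (hψnn : ∀ x : ℝ, 0 < x → x ≤ γ → 0 ≤ ψ x) :
    ∀ u : ℕ → ℝ, SeqBox γ u → b ≤ (fun w : ℕ → ℝ => b + ∑ k ∈ range K, L k * ψ (w k)) u :=
  fun _ hu => le_add_of_nonneg_right (sum_nonneg fun k _ => mul_nonneg (hL k) (hψnn _ (hu k).1 (hu k).2))

/-- … and has ZEROTH MOMENT `Λ·Σ_{k<K} L_k` when `ψ` is `Λ`-Lipschitz on ]0,γ]. [folklore] -/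
theorem shape_functional_zerothMoment (hL : ∀ k, 0 ≤ L k) (hΛ : 0 ≤ Λ)
    (hψlip : ∀ x x' : ℝ, 0 < x → x ≤ γ → 0 < x' → x' ≤ γ → |ψ x - ψ x'| ≤ Λ * |x - x'|) :
    ∀ u u' : ℕ → ℝ, SeqBox γ u → SeqBox γ u' → ∀ D : ℝ, (∀ j, |u j - u' j| ≤ D) →
      |(fun w : ℕ → ℝ => b + ∑ k ∈ range K, L k * ψ (w k)) u - (fun w : ℕ → ℝ => b + ∑ k ∈ range K, L k * ψ (w k)) u'| ≤
        (Λ * ∑ k ∈ range K, L k) * D := by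
  intro u u' hu hu' D hD
  simp only
  rw [add_sub_add_left_eq_sub, ← sum_sub_distrib, mul_sum, sum_mul]
  refine (abs_sum_le_sum_abs _ _).trans (sum_le_sum fun k _ => ?_)
  rw [← mul_sub, abs_mul, abs_of_nonneg (hL k)]
  have := hψlip _ _ (hu k).1 (hu k).2 (hu' k).1 (hu' k).2
  calc L k * |ψ (u k) - ψ (u' k)| ≤ L k * (Λ * |u k - u' k|) := mul_le_mul_of_nonneg_left this (hL k)
    _ ≤ L k * (Λ * D) := mul_le_mul_of_nonneg_left (mul_le_mul_of_nonneg_left (hD k) hΛ) (hL k)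
    _ = Λ * L k * D := by ring

/-- **THE MODEL `B(u) = b + Σ_{k<K} L_k·ψ(u_k)` COMPARES AT ANY SIZE UNDER THE PROFILE CONDITION** (`b > 0`, `L_k ≥ 0` of ANY sizes; `ψ ≥ 0` non-decreasing,
sub-homogeneous and `Λ`-Lipschitz on ]0,γ] — e.g. `min(u, σ)`, `u∕(1+u)`, `log(1+u)`; `Σ_{j<K} L_j∕P_j ≤ 2`): for every `B′ ≥ B` with a zeroth moment and
an ISOTONE excess, ANY box solutions from one pin satisfy `h′ ≤ h` at every scale.  `ψ = id` is (E58b) `le_of_isotone_excess_affine_profile`. [folklore] -/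
theorem le_of_isotone_excess_shape_profile {p : ℝ} (hL : ∀ k, 0 ≤ L k) (hb : 0 < b) (hΛ : 0 ≤ Λ)
    (hψnn : ∀ x : ℝ, 0 < x → x ≤ γ → 0 ≤ ψ x) (hψmono : ∀ x x' : ℝ, 0 < x → x ≤ x' → x' ≤ γ → ψ x ≤ ψ x')
    (hψsub : ∀ s x : ℝ, 0 ≤ s → s ≤ 1 → 0 < x → x ≤ γ → s * ψ x ≤ ψ (s * x))
    (hψlip : ∀ x x' : ℝ, 0 < x → x ≤ γ → 0 < x' → x' ≤ γ → |ψ x - ψ x'| ≤ Λ * |x - x'|)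
    (hP : ∑ j ∈ range K, L j / ∑ k ∈ range K, L k * Real.sqrt ((j : ℝ) / ((j : ℝ) + k)) ≤ 2)
    (hB' : ∀ u u' : ℕ → ℝ, SeqBox γ u → SeqBox γ u' → ∀ D : ℝ, (∀ j, |u j - u' j| ≤ D) → |B' u - B' u'| ≤ M' * D) (hM' : 0 ≤ M')
    (hexc : ∀ u, SeqBox γ u → (fun w : ℕ → ℝ => b + ∑ k ∈ range K, L k * ψ (w k)) u ≤ B' u)
    (hDmono : ∀ u v : ℕ → ℝ, SeqBox γ u → SeqBox γ v → (∀ j, u j ≤ v j) →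
      B' u - (fun w : ℕ → ℝ => b + ∑ k ∈ range K, L k * ψ (w k)) u ≤ B' v - (fun w : ℕ → ℝ => b + ∑ k ∈ range K, L k * ψ (w k)) v)
    (hp : 0 < p) (hpγ : p ≤ γ) (hh : SeqBox γ h) (hf : MemFlow (fun w : ℕ → ℝ => b + ∑ k ∈ range K, L k * ψ (w k)) p h)
    (hh' : SeqBox γ h') (hf' : MemFlow B' p h') (j : ℕ) : h' j ≤ h j := by
  refine le_of_isotone_excess_dom_shape_profile (B := fun w : ℕ → ℝ => b + ∑ k ∈ range K, L k * ψ (w k))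
    (shape_functional_monotone hL hψmono) (shape_functional_zerothMoment hL hΛ hψlip)
    (mul_nonneg hΛ (sum_nonneg fun k _ => hL k)) hL hb (shape_functional_floor hL hψnn) ?_ ?_ hψnn hψmono hψsub hP hB' hM' hexc hDmono
    hp hpγ hh hf hh' hf' j
  · intro u _; linarith
  · intro u u' _ _ _ _
    rw [add_sub_add_left_eq_sub, ← sum_sub_distrib]
    exact le_of_eq (sum_congr rfl fun k _ => by ring)

end Summit.QuantumFields.BalabanUV.Beta.EriceRemainderEnclosureHistoryAutonomyComparisonShapeProfile

end
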